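import Summits.QuantumFields.QCD.Theorems.WindowExtinction.Negative.SpectralFlowLocal

/-!
# Schur-complement locality: abstract entry and form bounds (lemma G6, abstract part)

Deterministic linear algebra for the modular cell–wall template (crux idea `Cruxes/TipPricing/Ideas/modular-cell-wall-template.md`,
lead c2; serves stub `stub_spreadOfCells` of line `hermitian-flow-coarea` r3 for crux `TipPricing`, stmt-QuantumFields-8967).
The inter-cell couplings of the template are entries of `C G Cᴴ` (`G` = inverse wall block, `C` = cell-to-wall hopping) between
indices of DIFFERENT cells; they are small because `G` decays between the (far apart) supports of the corresponding rows of `C`: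
* `norm_mul_mul_conjTranspose_apply_le` — `‖(C G Cᴴ) p q‖ ≤ h_p · B · h_q` when the rows `p`, `q` of `C` have absolute sums
  `≤ h_p, h_q` and `‖G x y‖ ≤ B` on the product of their supports;
* `abs_re_form_le_of_entry_le` — a matrix with all entries of norm `≤ ε` has form `|Re v†Mv| ≤ ε · card · Σ‖v‖²` (crude
  Cauchy–Schwarz; polynomial factors are harmless against the exponential decay);
* `inv_sub_inv_apply_eq` — the resolvent identity entrywise, `E⁻¹ − F⁻¹ = −E⁻¹ (E − F) F⁻¹` for invertible `E`, `F`, and the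
  resulting entry bound `norm_inv_sub_inv_apply_le` when `E − F` is supported on a "cut" where `F⁻¹` is small towards `y`.
Supports stmt-QuantumFields-8967 (helper; closes no item).
-/

namespace Summit.QuantumFields.QCD.Cruxes.TipPricing.ModularTemplate

open Matrix
open scoped BigOperators

section Entry

variable {ι κ : Type*} [Fintype κ]

/-- **Entry bound for `C G Cᴴ` through the supports of two rows of `C`.** [folklore] -/
theorem norm_mul_mul_conjTranspose_apply_le (C : Matrix ι κ ℂ) (G : Matrix κ κ ℂ) (p q : ι) {hp hq B : ℝ}
    (hB : 0 ≤ B) (hrowp : ∑ x, ‖C p x‖ ≤ hp) (hrowq : ∑ y, ‖C q y‖ ≤ hq)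
    (hG : ∀ x y, C p x ≠ 0 → C q y ≠ 0 → ‖G x y‖ ≤ B) :
    ‖(C * G * Cᴴ) p q‖ ≤ hp * B * hq := by
  rw [Matrix.mul_apply]
  calc ‖∑ y, (C * G) p y * Cᴴ y q‖ ≤ ∑ y, ‖(C * G) p y * Cᴴ y q‖ := norm_sum_le _ _
    _ = ∑ y, ‖(C * G) p y‖ * ‖C q y‖ := Finset.sum_congr rfl fun y _ => by
        rw [norm_mul, conjTranspose_apply, norm_star]
    _ ≤ ∑ y, (hp * B) * ‖C q y‖ := by
        refine Finset.sum_le_sum fun y _ => ?_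
        by_cases hCq : C q y = 0
        · rw [hCq, norm_zero, mul_zero, mul_zero]
        · refine mul_le_mul_of_nonneg_right ?_ (norm_nonneg _)
          rw [Matrix.mul_apply]
          calc ‖∑ x, C p x * G x y‖ ≤ ∑ x, ‖C p x * G x y‖ := norm_sum_le _ _
            _ = ∑ x, ‖C p x‖ * ‖G x y‖ := Finset.sum_congr rfl fun x _ => norm_mul _ _
            _ ≤ ∑ x, ‖C p x‖ * B := by
                refine Finset.sum_le_sum fun x _ => ?_
                by_cases hCp : C p x = 0
                · rw [hCp, norm_zero, zero_mul, zero_mul]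
                · exact mul_le_mul_of_nonneg_left (hG x y hCp hCq) (norm_nonneg _)
            _ = (∑ x, ‖C p x‖) * B := (Finset.sum_mul _ _ _).symm
            _ ≤ hp * B := mul_le_mul_of_nonneg_right hrowp hB
    _ = (hp * B) * ∑ y, ‖C q y‖ := (Finset.mul_sum _ _ _).symm
    _ ≤ (hp * B) * hq := mul_le_mul_of_nonneg_left hrowq (mul_nonneg
        ((Finset.sum_nonneg fun x _ => norm_nonneg _).trans hrowp) hB)
    _ = hp * B * hq := by ring

/-- **Crude form bound from an entry bound**: `|Re v† M v| ≤ ε · card ι · Σ‖v‖²` if all `‖M p q‖ ≤ ε`. [folklore] -/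
theorem abs_re_form_le_of_entry_le [Fintype ι] (M : Matrix ι ι ℂ) {ε : ℝ} (hε : 0 ≤ ε) (hM : ∀ p q, ‖M p q‖ ≤ ε) (v : ι → ℂ) :
    |(star v ⬝ᵥ M *ᵥ v).re| ≤ ε * Fintype.card ι * ∑ p, ‖v p‖ ^ 2 := by
  -- |v† M v| ≤ Σ_{p,q} ε |v_p| |v_q| = ε (Σ|v|)² ≤ ε · card · Σ|v|²
  have h1 : |(star v ⬝ᵥ M *ᵥ v).re| ≤ ‖star v ⬝ᵥ M *ᵥ v‖ := Complex.abs_re_le_norm _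
  have h2 : ‖star v ⬝ᵥ M *ᵥ v‖ ≤ ε * (∑ p, ‖v p‖) ^ 2 := by
    rw [dotProduct]
    calc ‖∑ p, star v p * (M *ᵥ v) p‖ ≤ ∑ p, ‖star v p * (M *ᵥ v) p‖ := norm_sum_le _ _
      _ = ∑ p, ‖v p‖ * ‖(M *ᵥ v) p‖ := Finset.sum_congr rfl fun p _ => by rw [norm_mul, Pi.star_apply, norm_star]
      _ ≤ ∑ p, ‖v p‖ * (ε * ∑ q, ‖v q‖) := by
          refine Finset.sum_le_sum fun p _ => mul_le_mul_of_nonneg_left ?_ (norm_nonneg _)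
          rw [mulVec, dotProduct]
          calc ‖∑ q, M p q * v q‖ ≤ ∑ q, ‖M p q * v q‖ := norm_sum_le _ _
            _ ≤ ∑ q, ε * ‖v q‖ := Finset.sum_le_sum fun q _ => by
                rw [norm_mul]; exact mul_le_mul_of_nonneg_right (hM p q) (norm_nonneg _)
            _ = ε * ∑ q, ‖v q‖ := (Finset.mul_sum _ _ _).symm
      _ = ε * (∑ p, ‖v p‖) ^ 2 := by rw [← Finset.sum_mul, sq]; ring
  have h3 : (∑ p, ‖v p‖) ^ 2 ≤ Fintype.card ι * ∑ p, ‖v p‖ ^ 2 := by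
    have := sq_sum_le_card_mul_sum_sq (s := (Finset.univ : Finset ι)) (f := fun p => ‖v p‖)
    simpa [Finset.card_univ] using this
  calc |(star v ⬝ᵥ M *ᵥ v).re| ≤ ε * (∑ p, ‖v p‖) ^ 2 := h1.trans h2
    _ ≤ ε * (Fintype.card ι * ∑ p, ‖v p‖ ^ 2) := mul_le_mul_of_nonneg_left h3 hε
    _ = ε * Fintype.card ι * ∑ p, ‖v p‖ ^ 2 := by ring

end Entry

section Resolvent

variable {κ : Type*} [Fintype κ] [DecidableEq κ]

/-- **Resolvent identity**: `E⁻¹ − F⁻¹ = −(E⁻¹ (E − F) F⁻¹)` for invertible `E`, `F`. [folklore] -/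
theorem inv_sub_inv_eq_neg (E F : Matrix κ κ ℂ) (hE : IsUnit E.det) (hF : IsUnit F.det) :
    E⁻¹ - F⁻¹ = -(E⁻¹ * (E - F) * F⁻¹) := by
  rw [Matrix.mul_sub, Matrix.sub_mul, Matrix.nonsing_inv_mul _ hE, Matrix.one_mul, Matrix.mul_assoc,
    Matrix.mul_nonsing_inv _ hF, Matrix.mul_one, neg_sub]

/-- **Entry bound for the difference of inverses through a cut.**  If all entries of `E⁻¹` are `≤ M_E` in norm, the rows of
`T = E − F` have absolute sums `≤ h_T`, and `‖F⁻¹ z' y‖ ≤ B` whenever `z'` lies in the column support of `T` (the "cut"), then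
`‖(E⁻¹ − F⁻¹) x y‖ ≤ M_E · (card κ · h_T) · B`. [folklore] -/
theorem norm_inv_sub_inv_apply_le (E F : Matrix κ κ ℂ) (hE : IsUnit E.det) (hF : IsUnit F.det) (x y : κ)
    {ME hT B : ℝ} (hME : 0 ≤ ME) (hB : 0 ≤ B)
    (hEinv : ∀ x z, ‖E⁻¹ x z‖ ≤ ME) (hTrow : ∀ z, ∑ z', ‖(E - F) z z'‖ ≤ hT)
    (hFinv : ∀ z z', (E - F) z z' ≠ 0 → ‖F⁻¹ z' y‖ ≤ B) :
    ‖(E⁻¹ - F⁻¹) x y‖ ≤ ME * (Fintype.card κ * hT) * B := by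
  rw [inv_sub_inv_eq_neg E F hE hF, Matrix.neg_apply, norm_neg, Matrix.mul_apply]
  calc ‖∑ z', (E⁻¹ * (E - F)) x z' * F⁻¹ z' y‖ ≤ ∑ z', ‖(E⁻¹ * (E - F)) x z' * F⁻¹ z' y‖ := norm_sum_le _ _
    _ ≤ ∑ z', ∑ z, ‖E⁻¹ x z‖ * ‖(E - F) z z'‖ * ‖F⁻¹ z' y‖ := by
        refine Finset.sum_le_sum fun z' _ => ?_
        rw [norm_mul, Matrix.mul_apply, ← Finset.sum_mul]
        refine mul_le_mul_of_nonneg_right ?_ (norm_nonneg _)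
        calc ‖∑ z, E⁻¹ x z * (E - F) z z'‖ ≤ ∑ z, ‖E⁻¹ x z * (E - F) z z'‖ := norm_sum_le _ _
          _ = ∑ z, ‖E⁻¹ x z‖ * ‖(E - F) z z'‖ := Finset.sum_congr rfl fun z _ => norm_mul _ _
    _ ≤ ∑ z', ∑ z, ME * ‖(E - F) z z'‖ * B := by
        refine Finset.sum_le_sum fun z' _ => Finset.sum_le_sum fun z _ => ?_
        by_cases hT : (E - F) z z' = 0
        · rw [hT, norm_zero, mul_zero, zero_mul, mul_zero, zero_mul]
        · have h1 := hEinv x z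
          have h2 := hFinv z z' hT
          have h3 : 0 ≤ ‖(E - F) z z'‖ := norm_nonneg _
          calc ‖E⁻¹ x z‖ * ‖(E - F) z z'‖ * ‖F⁻¹ z' y‖ ≤ ME * ‖(E - F) z z'‖ * ‖F⁻¹ z' y‖ :=
                mul_le_mul_of_nonneg_right (mul_le_mul_of_nonneg_right h1 h3) (norm_nonneg _)
            _ ≤ ME * ‖(E - F) z z'‖ * B := mul_le_mul_of_nonneg_left h2 (mul_nonneg hME h3)
    _ = ME * B * ∑ z, ∑ z', ‖(E - F) z z'‖ := by
        rw [Finset.sum_comm, Finset.mul_sum]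
        refine Finset.sum_congr rfl fun z _ => ?_
        rw [Finset.mul_sum]
        refine Finset.sum_congr rfl fun z' _ => ?_
        ring
    _ ≤ ME * B * ∑ _z : κ, hT := by
        refine mul_le_mul_of_nonneg_left (Finset.sum_le_sum fun z _ => hTrow z) (mul_nonneg hME hB)
    _ = ME * (Fintype.card κ * hT) * B := by
        rw [Finset.sum_const, Finset.card_univ, nsmul_eq_mul]; ring

end Resolvent

end Summit.QuantumFields.QCD.Cruxes.TipPricing.ModularTemplate
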